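import Literature.IUT.HodgeTheaters.BadLocalFrobenioidOfKits
import Literature.AnabelianGeometry.EtaleTheta.Discharge.Sec3Cor38iiSelfEquivalenceWeak
import Literature.AnabelianGeometry.EtaleTheta.Discharge.Sec3Remark363
import Literature.AnabelianGeometry.SemiGraphs.CosetCategoriesFSM
import HarnessLib

/-!
# [IUTchI] Example 3.2 with `F̲_v` an [EtTh] Def. 3.6 tempered Frobenioid over the REAL base `D_v`: the assembly
# `ofKits` over `TemperedThetaRest.toInput`, and (iii) "`C_v` may be reconstructed category-theoretically from `F̲_v`"
# DISCHARGED at it from [EtTh] Cor. 3.8 (ii) (MERGE L5 × L2 × L1)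

Mochizuki, *Inter-universal Teichmüller Theory I*, kurims manuscript (May 2020), Example 3.2 (i) p. 70, (iii) p. 71
[cite: Mochizuki2012, I Ex 3.2 (i)(iii) pp.70-71]: (i) "the hyperbolic curve `X̲̲_v` determines a tempered Frobenioid
`F̲_v` … over a base category `D_v`"; (iii) "the `p_v`-adic Frobenioid constituted by the 'base-field-theoretic hull'
[cf. [EtTh], Remark 3.6.2] `C_v ⊆ F̲_v` [i.e., we write `C_v` for the subcategory '`C^{bs-fld}`' of [EtTh], Definition
3.6, (iv)] may be reconstructed category-theoretically from `F̲_v` [cf. Remark 3.2.1 below]" (D-0012 claim key,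
status disputed; nothing of the series is asserted).

In `BadLocalFrobenioidOfKits.lean` (abc-iut-L5-t2) the tempered side is the INPUT `TemperedThetaInput` on abstract
carriers `Fv`, `Cv`. THIS FILE specialises those two carriers to abc-iut-L2-t3's [EtTh] Def. 3.6 objects over the REAL
base `D_v = CosetCat Π_v` (L5-lead RULINGS #58 (4) pointer: abc-iut-L1-t12's `TemperedFrobenioid.hull_selfEquivalence…`):
* `TemperedThetaRest d T hq C Fbirat` — the input that REMAINS once `F̲_v := C.category` is an [EtTh] Def. 3.6 tempered
  Frobenioid `C : TemperedFrobenioid T' T.Dv VD` (abc-iut-L2-t3 `TemperedFrobenioid.lean`; a structure over the L2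
  realified divisor-monoid data `T'` — themselves the [EtTh] §3 inputs) and `C_v := C.hullCategory` its
  base-field-theoretic hull ([EtTh] Def. 3.6 (iv), abc-iut-L2-t3 `TemperedFrobenioidHull.lean`): the birationalization
  side (`F÷_v`, `𝒪^×(T^÷_Ÿ) ∋ Θ̲_v`, constants), `l·ℤ`, `C⊢_v → C_v` and `C^Θ_v ⊆ F÷_v`
  [cite: MochizukiEtTh2009, Def 3.6 p.77];
* `TemperedThetaRest.toInput` — the corresponding `TemperedThetaInput`: `F̲_v → D_v :=` the model-Frobenioid base
  functor, `T_A := (A, 0)` the Frobenius-trivial object (REAL), `C_v ⊆ F̲_v := C.hull`, FAITHFUL by abc-iut-L2's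
  UNCONDITIONAL `TemperedFrobenioid.hullFaithful_holds` ([EtTh] p. 78 "a natural faithful functor");
* **`BadLocalFrobenioid.cFromF_ofKits_toInput`** — Ex. 3.2 (iii), typed by abc-iut-L5-t2 as `CFromF B :=
  ReconstructibleAlong B.hull`, HOLDS at `ofKits … R.toInput` by abc-iut-L1-t12's `hull_selfEquivalence_weak_of_criteria`
  ([EtTh] Cor. 3.8 (ii) for self-equivalences over the weak vocabulary), modulo exactly that theorem's [EtTh]/[FrdI]
  hypotheses on `C` (`hnd` non-dilating, `hds` Div-slim, `hF` [FrdI] Thm. 5.2 (ii), `h5` C38-L05, `hR` Rmk. 3.6.3);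
  FSMFF-type of the base is DISCHARGED (`CosetCat.isOfFSMType`).
Universe: the interface forces `D_v : Type 0`, hence the L2 vocabularies at `w = 0`. Nothing of the disputed series is
asserted; (iii) is discharged AT THIS INSTANCE only (it is a schema: abc-iut-w4-d047's doubling model); typed ≠ proved.
-/

noncomputable section

namespace Literature.IUT.HodgeTheaters

open CategoryTheory Opposite Literature.AnabelianGeometry.SemiGraphs Literature.AlgebraicGeometry.Frobenioids
open Literature.AlgebraicGeometry.Frobenioids.PadicFrd Literature.AnabelianGeometry.EtaleTheta

universe u₀ v₀

/-- **INPUT remaining when `F̲_v` IS an [EtTh] Def. 3.6 tempered Frobenioid `C` over `D_v` and `C_v := C^{bs-fld}`**: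
(ii) `F÷_v` with `F̲_v → F÷_v → D_v`, `𝒪^×(T^÷_{Ÿ_v}) ∋ Θ̲_v`, `l·ℤ ⊆ Aut(T_{Ÿ_v})`, the constants
`𝒪^×_{K_v} → 𝒪^×(T^÷_{Ÿ_v})`; (iv) `C⊢_v → C_v` faithful over `D⊢_v ⊆ D_v` ("`C⊢_v (⊆ C_v ⊆ F̲_v)`", i.e.
`ℕ·log_Φ(q̲_v)|_{D⊢_v} ⊆ Φ_{C_v}|_{D⊢_v}`); (v) `C^Θ_v ⊆ F÷_v` faithful over `D^Θ_v → D_v`.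
[cite: Mochizuki2012, I Ex 3.2 pp.69-73] -/
structure TemperedThetaRest {p : ℕ} [Fact p.Prime] (d : GaloisValDatum.{0} p) {P : Type} [Group P]
    [TopologicalSpace P] (T : BadLocalGroupDatum d.Gal P) {qroot : intNonzero d.k} (hq : ¬ IsUnit qroot)
    {D₀ : Type u₀} [Category.{v₀} D₀] {V : FrdIMonoidStub.{0}} {T' : RealifiedDivisorMonoids (D₀ := D₀) V}
    {VD : FrdICatStub.{0, 0, 0} T.Dv} (C : TemperedFrobenioid T' T.Dv VD) (Fbirat : Type) [Category.{0} Fbirat] where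
  /-- (ii) `F̲_v → F÷_v` … -/
  birat : C.category ⥤ Fbirat
  /-- … `F÷_v → D_v` … -/
  biratBase : Fbirat ⥤ T.Dv
  /-- … compatibly with `F̲_v → D_v` -/
  birat_base : Nonempty (birat ⋙ biratBase ≅ C.baseFunctorOfCategory)
  /-- (ii) `𝒪^×(T^÷_{Ÿ_v})`, for the Frobenius-trivial object `T_{Ÿ_v} = (Ÿ_v, 0)` … -/
  unitsTY : Subgroup (Aut (birat.obj (⟨T.ydd, 1⟩ : C.category)))
  /-- … commutative -/
  unitsTY_comm : ∀ x ∈ unitsTY, ∀ y ∈ unitsTY, x * y = y * x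
  /-- (ii) `Θ̲_v` … -/
  theta : Aut (birat.obj (⟨T.ydd, 1⟩ : C.category))
  /-- … `∈ 𝒪^×(T^÷_{Ÿ_v})` -/
  theta_mem : theta ∈ unitsTY
  /-- (ii) `l·ℤ ⊆ Aut(T_{Ÿ_v})` -/
  lZ : Subgroup (Aut (⟨T.ydd, 1⟩ : C.category))
  /-- (v) the constants `𝒪^×_{K_v} → 𝒪^×(T^÷_{Ÿ_v})` -/
  constUnits : (intNonzero d.k)ˣ →* unitsTY
  /-- (iv) `C⊢_v → C_v = C^{bs-fld}` … -/
  CdashToC : d.Cdash hq ⥤ C.hullCategory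
  /-- … faithful … -/
  CdashToC_faithful : CdashToC.Faithful
  /-- … over `D⊢_v ⊆ D_v` -/
  CdashToC_base : Nonempty (CdashToC ⋙ C.hull ⋙ C.baseFunctorOfCategory ≅ d.CdashBase hq ⋙ T.incl)
  /-- (v) `C^Θ_v ⊆ F÷_v` … -/
  CThetaToBirat : T.CTheta d hq ⥤ Fbirat
  /-- … faithful … -/
  CThetaToBirat_faithful : CThetaToBirat.Faithful
  /-- … over `D^Θ_v ⊆ (D_v)_{Ÿ_v} → D_v` -/
  CThetaToBirat_base : Nonempty (CThetaToBirat ⋙ biratBase ≅ T.CThetaBase d hq ⋙ T.dThetaIncl ⋙ Over.forget T.ydd)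

namespace TemperedThetaRest

variable {p : ℕ} [Fact p.Prime] {d : GaloisValDatum.{0} p} {P : Type} [Group P] [TopologicalSpace P]
  {T : BadLocalGroupDatum d.Gal P} {qroot : intNonzero d.k} {hq : ¬ IsUnit qroot}
  {D₀ : Type u₀} [Category.{v₀} D₀] {V : FrdIMonoidStub.{0}} {T' : RealifiedDivisorMonoids (D₀ := D₀) V}
  {VD : FrdICatStub.{0, 0, 0} T.Dv} {C : TemperedFrobenioid T' T.Dv VD} {Fbirat : Type} [Category.{0} Fbirat]
  (R : TemperedThetaRest d T hq C Fbirat)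

/-- **The tempered-side input with `F̲_v := C.category`, `T_A := (A, 0)`, `C_v := C^{bs-fld}`, `C_v ⊆ F̲_v := C.hull`**
(faithful: abc-iut-L2's `hullFaithful_holds`, unconditional). [cite: Mochizuki2012, I Ex 3.2 (i)(iii) pp.70-71] -/
def toInput : TemperedThetaInput d T hq C.category Fbirat C.hullCategory where
  toBase := C.baseFunctorOfCategory
  Tobj A := ⟨A, 1⟩
  Tobj_base A := Iso.refl A
  birat := R.birat
  biratBase := R.biratBase
  birat_base := R.birat_base
  unitsTY := R.unitsTY
  unitsTY_comm := R.unitsTY_comm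
  theta := R.theta
  theta_mem := R.theta_mem
  lZ := R.lZ
  constUnits := R.constUnits
  hull := C.hull
  hull_faithful := C.hullFaithful_holds
  CdashToC := R.CdashToC
  CdashToC_faithful := R.CdashToC_faithful
  CdashToC_base := R.CdashToC_base
  CThetaToBirat := R.CThetaToBirat
  CThetaToBirat_faithful := R.CThetaToBirat_faithful
  CThetaToBirat_base := R.CThetaToBirat_base

/-- `F̲_v` of `toInput` IS `C` and `C_v ⊆ F̲_v` IS its base-field-theoretic hull. [cite: Mochizuki2012, I Ex 3.2 (iii) p.71] -/
theorem toInput_hull : R.toInput.hull = C.hull := rfl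

/-- `T_A` of `toInput` IS the Frobenius-trivial object `(A, 0)` of the model Frobenioid. [cite: Mochizuki2012, I Ex 3.2 (i) p.70] -/
theorem toInput_Tobj (A : T.Dv) : R.toInput.Tobj A = ⟨A, 1⟩ := rfl

end TemperedThetaRest

/-! ### Example 3.2 (iii) at `ofKits` over a tempered Frobenioid ([EtTh] Cor. 3.8 (ii)) -/

namespace BadLocalFrobenioid

variable {p : ℕ} [Fact p.Prime] (l : ℕ) (d : GaloisValDatum.{0} p) {P : Type} [Group P] [TopologicalSpace P]
  [IsTopologicalGroup P] (T : BadLocalGroupDatum d.Gal P) (q qroot : intNonzero d.k) (hpow : qroot ^ (2 * l) = q)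
  (hq : ¬ IsUnit qroot) {D₀ : Type u₀} [Category.{v₀} D₀]
  {T' : RealifiedDivisorMonoids (D₀ := D₀) treeMonoidVocabWeak.{0}} {VD : FrdICatStub.{0, 0, 0} T.Dv}
  (C : TemperedFrobenioid T' T.Dv VD) {Fbirat : Type} [Category.{0} Fbirat] (R : TemperedThetaRest d T hq C Fbirat)

/-- `D_v = CosetCat Π_v` is of FSMFF-type ([FrdII] Ex. 1.3 (i), abc-iut-L1's `CosetCat.isOfFSMType`).
[cite: MochizukiFrdII2008, Ex 1.3 (i) p.11] -/
theorem isOfFSMFFType_Dv : IsOfFSMFFType T.Dv := (CosetCat.isOfFSMType (G := P)).isOfFSMFFType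

/-- **[IUTchI] Ex. 3.2 (iii) DISCHARGED at `ofKits` over an [EtTh] tempered Frobenioid**: "`C_v ⊆ F̲_v` may be
reconstructed category-theoretically from `F̲_v`" — abc-iut-L5-t2's `CFromF = ReconstructibleAlong hull` — holds for
`ofKits … R.toInput` by abc-iut-L1-t12's `TemperedFrobenioid.hull_selfEquivalence_weak_of_criteria` ([EtTh] Cor. 3.8
(ii), self-equivalence form over the weak vocabulary), modulo that theorem's hypotheses on `C` (`hnd`, `hds`, `hF`, `h5`,
`hR`); the FSMFF-type of the base `D_v = CosetCat Π_v` is discharged. [claim: Mochizuki2012, status: disputed] -/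
theorem cFromF_ofKits_toInput
    (hnd : ∀ (A : T.Dvᵒᵖ) (f : A ⟶ A), treeMonoidVocabWeak.{0}.IsNonDilating (C.Φ.carrier A) (C.Φ.pull f))
    (hds : ∀ (A : T.Dv) (α : Aut (Over.forget A)),
      (∀ (B : Over A) (x : C.divisorMonoid.obj (op B.left)),
        Literature.AlgebraicGeometry.Frobenioids.pull C.divisorMonoid (α.hom.app B) x = x) → α = 1)
    (hF : PreFrobenioid.IsFrobenioid C.toElem)
    (h5 : C.BsFldPreStepLimitCriterion (PreFrobenioidData.perfection hF)) (hR : C.Remark363) :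
    (ofKits l d T q qroot hpow hq R.toInput).CFromF := fun e =>
  (C.hull_selfEquivalence_weak_of_criteria (isOfFSMFFType_Dv d T) hnd hds hF h5 hR e).2

/-- The first half of [EtTh] Cor. 3.8 (ii) at the same instance: every self-equivalence of `F̲_v` preserves the
base-field-theoretic morphisms. [claim: Mochizuki2012, status: disputed] -/
theorem isBaseFieldTheoretic_iff_of_selfEquivalence
    (hnd : ∀ (A : T.Dvᵒᵖ) (f : A ⟶ A), treeMonoidVocabWeak.{0}.IsNonDilating (C.Φ.carrier A) (C.Φ.pull f))
    (hds : ∀ (A : T.Dv) (α : Aut (Over.forget A)),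
      (∀ (B : Over A) (x : C.divisorMonoid.obj (op B.left)),
        Literature.AlgebraicGeometry.Frobenioids.pull C.divisorMonoid (α.hom.app B) x = x) → α = 1)
    (hF : PreFrobenioid.IsFrobenioid C.toElem)
    (h5 : C.BsFldPreStepLimitCriterion (PreFrobenioidData.perfection hF)) (hR : C.Remark363)
    (e : (ofKits l d T q qroot hpow hq R.toInput).Fv ≌ (ofKits l d T q qroot hpow hq R.toInput).Fv)
    {A B : C.category} (f : A ⟶ B) :
    C.IsBaseFieldTheoretic f ↔ C.IsBaseFieldTheoretic (e.functor.map f) :=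
  (C.hull_selfEquivalence_weak_of_criteria (isOfFSMFFType_Dv d T) hnd hds hF h5 hR e).1 f

end BadLocalFrobenioid

end Literature.IUT.HodgeTheaters

end
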